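import Summits.ABC.StewartYu.PadicTwoAssembly
import HarnessLib

/-!
# Cell abc-stewartyu, W80Two (x): the third-step inequality in logarithmic form and the one-call
# provider of `ThirdStep`

`Summits/ABC/StewartYu/PadicTwoThirdLog.lean` — cell `abc-stewartyu` (seat p2; crux `W80Two`
stmt-ABC-19486), sequel to `PadicTwoAssembly.lean`.  Theorems only; no named fact.  The `p = 2` twin of
p2's `TwistSetup.hFinalHalf_of_log_ineq` (the parameter record proves two inequalities between LOGARITHMS;
the machine wants the third-point inequality between REALS):

* `thirdFinal3_of_log_ineq` — with `N` the node range and `E` the Liouville exponent, if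
  `‖Λ₀‖₂ ≤ e^{−U}`, (1) `(hLb + t + condExp 2 N t)·log 2 + E·log(6·D·M·Hp) < U` and
  (2) `hLb·log 8 + E·log(6·D·M·Hp) < (2⌊N/3⌋·t)·log 4`, then
  `max (2^{hLb} ‖Λ₀‖₂ 2ᵗ 2^{condExp 2 N t}) (8^{hLb}/4^{2⌊N/3⌋·t}) < 1/(6·D·M·Hp)^E`;
* **`thirdStep_of_log_ineq`** — the ONE-CALL provider of the `Prop` `ThirdStep` for the pack: per-`(s,τ)`
  denominators `D(s,τ) ≤ Dmax` and `ℓ¹`-majorants `Mb(s,τ) ≤ Mmax`, integer generators with cube-Kummer,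
  and the two log-inequalities at `(Dmax, Mmax, Hp := ∏ max(1,|allᵢ|))` with `N := 3^{d+J} S₀`,
  `E := 3^{d+2} − 1` (`thirdStep_of_numerics` ∘ `thirdFinal3_of_log_ineq` ∘ p3's antitonicity
  `SetupQ.thirdThreshold_anti`).

## References
* [Yu1989] K. Yu, Acta Arith. 53 (1989), §3 Lemmas 3.4–3.5.
* [Waldschmidt1980] M. Waldschmidt, Acta Arith. 37 (1980), Lemma 3.7 (p. 272).
-/

noncomputable section

open NormedSpace Finset IsUltrametricDist
open Literature.NumberTheory.Transcendental
open Literature.NumberTheory.Transcendental.CW77.Setup (Idx Tau tauNorm)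
open Literature.NumberTheory.Transcendental.PadicCW77 (condExp)
open scoped Nat

namespace Summit.ABC.StewartYu

namespace TwoSetup

variable (S : TwoSetup) {h Lb : ℕ}

/-- **The third-point inequality from two inequalities between logarithms**: with node range `N`,
multiplicity `t` and Liouville exponent `E`, if `‖Λ₀‖₂ ≤ e^{−U}`,
(1) `(hLb + t + condExp 2 N t)·log 2 + E·log(6·D·M·Hp) < U` and
(2) `hLb·log 8 + E·log(6·D·M·Hp) < (2⌊N/3⌋·t)·log 4`, then
`max (2^{hLb} ‖Λ₀‖₂ 2ᵗ 2^{condExp 2 N t}) (8^{hLb}/4^{2⌊N/3⌋·t}) < 1/(6·D·M·Hp)^E`.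
[cite: Yu1989, §3 Lemma 3.4] [cite: Waldschmidt1980, Lemma 3.7 (p. 272)] -/
theorem thirdFinal3_of_log_ineq {U : ℝ} (N t E : ℕ) {D M Hp : ℝ} (hΛ : ‖S.Λ₀‖ ≤ Real.exp (-U))
    (hD : 0 < D) (hM : 0 < M) (hHp : 0 < Hp)
    (h1 : ((h * Lb + t + condExp 2 N t : ℕ) : ℝ) * Real.log 2 + E * Real.log (6 * D * M * Hp) < U)
    (h2 : ((h * Lb : ℕ) : ℝ) * Real.log 8 + E * Real.log (6 * D * M * Hp) <
      ((2 * (N / 3) * t : ℕ) : ℝ) * Real.log 4) :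
    max ((2 : ℝ) ^ (h * Lb) * ‖S.Λ₀‖ * (2 : ℝ) ^ t * (2 : ℝ) ^ condExp 2 N t)
        ((8 : ℝ) ^ (h * Lb) / (4 : ℝ) ^ (2 * (N / 3) * t)) <
      1 / (6 * D * M * Hp) ^ E := by
  have hQ : 0 < 6 * D * M * Hp := by positivity
  have hrhs : 1 / (6 * D * M * Hp) ^ E = Real.exp (-(E * Real.log (6 * D * M * Hp))) := by
    rw [Real.exp_neg, ← Real.log_pow, Real.exp_log (pow_pos hQ E), one_div]
  rw [hrhs]
  refine max_lt ?_ ?_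
  · rcases (norm_nonneg S.Λ₀).eq_or_lt with h0 | hpos
    · rw [← h0]; simp [Real.exp_pos]
    · have e1 : (2 : ℝ) ^ (h * Lb) * ‖S.Λ₀‖ * (2 : ℝ) ^ t * (2 : ℝ) ^ condExp 2 N t =
          Real.exp (((h * Lb : ℕ) : ℝ) * Real.log 2 + Real.log ‖S.Λ₀‖ +
            ((t : ℕ) : ℝ) * Real.log 2 + (condExp 2 N t : ℝ) * Real.log 2) := by
        rw [two_pow_eq_exp, two_pow_eq_exp, two_pow_eq_exp, ← Real.exp_log hpos]
        simp only [← Real.exp_add, Real.log_exp]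
      rw [e1, Real.exp_lt_exp]
      have hlog : Real.log ‖S.Λ₀‖ ≤ -U := by
        have := Real.log_le_log hpos hΛ; rwa [Real.log_exp] at this
      push_cast at h1 ⊢
      linarith
  · have e2 : (8 : ℝ) ^ (h * Lb) / (4 : ℝ) ^ (2 * (N / 3) * t) =
        Real.exp (((h * Lb : ℕ) : ℝ) * Real.log 8 - ((2 * (N / 3) * t : ℕ) : ℝ) * Real.log 4) := by
      rw [eight_pow_eq_exp, four_pow_eq_exp, ← Real.exp_sub]
    rw [e2, Real.exp_lt_exp]
    linarith

/-- **The third step from two inequalities between logarithms at uniform majorants** (the pack's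
one-call provider): integer generators with the cube-Kummer condition; `t ≥ 1`; `‖Λ₀‖₂ ≤ e^{−U}` with
`log 8 ≤ U`; room `|τ| < T/3^{J+1} ⇒ |τ| + t ≤ T/3ᴶ − d t`; per-`(s,τ)` denominators `1 ≤ D(s,τ) ≤ Dmax`
of the third-point weights `qΔ3_{J+1} qA♭ qEt` on the box of level `J` and majorants
`1 ≤ Mb(s,τ) ≤ Mmax` of `∑_u P·|qΔ3_{J+1} qA♭ qEt|`; and the two log-inequalities at
`(N, E, D, M, Hp) := (3^{d+J} S₀, 3^{d+2} − 1, Dmax, Mmax, ∏ᵢ max(1,|allᵢ|))`. Then `ThirdStep` holds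
(`thirdStep_of_numerics`, `thirdFinal3_of_log_ineq`, and the antitonicity `SetupQ.thirdThreshold_anti`
of the threshold in `(D, M)`). [cite: Yu1989, §3 Lemmas 3.4–3.5] -/
theorem thirdStep_of_log_ineq {J₀ J : ℕ} (hJ : J < J₀) {L : Fin S.d → ℕ} {Lθ S₀ T t : ℕ} {P : ℤ}
    (ht : 1 ≤ t) {U : ℝ} (hΛ : ‖S.Λ₀‖ ≤ Real.exp (-U)) (hU8 : Real.log 8 ≤ U)
    (hroom : ∀ τ : Tau S.d, tauNorm τ < T / 3 ^ (J + 1) → tauNorm τ + t ≤ T / 3 ^ J - S.d * t)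
    (hint : ∀ i, ∃ a : ℤ, S.toQ.all i = a)
    (hind : ∀ κ : Fin (S.d + 1) → ℕ, (∃ j, ¬ 3 ∣ κ j) → ∀ γ : ℚ, ∏ j, S.toQ.all j ^ κ j ≠ γ ^ 3)
    (D : ℕ → Tau S.d → ℕ) (hD : ∀ s τ, 1 ≤ D s τ)
    (hDc : ∀ s (τ : Tau S.d), ∀ u ∈ S.toQ.box3 (h := h) (Lb := Lb) L Lθ J,
      ∃ z : ℤ, (D s τ : ℚ) *
        ((S.toQ.qΔ3 J₀ (J + 1) u τ.1 s * S.frame.qA u τ.2) * S.toQ.qEt u s) = z)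
    (Mb : ℕ → Tau S.d → ℝ) (hMb : ∀ s τ, 1 ≤ Mb s τ)
    (hMbP : ∀ s (τ : Tau S.d), ∑ u ∈ S.toQ.box3 (h := h) (Lb := Lb) L Lθ J,
      (P : ℝ) * |((S.toQ.qΔ3 J₀ (J + 1) u τ.1 s * S.frame.qA u τ.2 * S.toQ.qEt u s : ℚ) : ℝ)| ≤
        Mb s τ)
    {Dmax Mmax : ℝ} (hDle : ∀ s τ, (D s τ : ℝ) ≤ Dmax) (hMle : ∀ s τ, Mb s τ ≤ Mmax)
    (h1 : ((h * Lb + t + condExp 2 (3 ^ (S.d + J) * S₀) t : ℕ) : ℝ) * Real.log 2 +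
        ((3 ^ (S.d + 1 + 1) - 1 : ℕ) : ℝ) *
          Real.log (6 * Dmax * Mmax * ∏ i, max 1 |(S.toQ.all i : ℝ)|) < U)
    (h2 : ((h * Lb : ℕ) : ℝ) * Real.log 8 +
        ((3 ^ (S.d + 1 + 1) - 1 : ℕ) : ℝ) *
          Real.log (6 * Dmax * Mmax * ∏ i, max 1 |(S.toQ.all i : ℝ)|) <
      ((2 * (3 ^ (S.d + J) * S₀ / 3) * t : ℕ) : ℝ) * Real.log 4) :
    S.ThirdStep (h := h) (Lb := Lb) J₀ J L Lθ S₀ T t P := by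
  have hΛ8 : ‖S.Λ₀‖ ≤ (8 : ℝ)⁻¹ := by
    refine hΛ.trans ?_
    rw [← Real.exp_log (by norm_num : (0 : ℝ) < 8), ← Real.exp_neg, Real.exp_le_exp]
    exact neg_le_neg hU8
  have hHp : 0 < ∏ i, max 1 |(S.toQ.all i : ℝ)| :=
    prod_pos fun i _ => lt_of_lt_of_le one_pos (le_max_left _ _)
  -- some `(s,τ)` exists in the statement only through `D`, `Mb`; positivity of the majorants
  refine S.thirdStep_of_numerics hJ ht hΛ8 hroom hint hind D hD hDc Mb hMb hMbP fun s _ _ τ _ => ?_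
  have hD0 : (0 : ℝ) < D s τ := by exact_mod_cast hD s τ
  have hM0 : 0 < Mb s τ := lt_of_lt_of_le one_pos (hMb s τ)
  have hDmax : 0 < Dmax := lt_of_lt_of_le hD0 (hDle s τ)
  have hMmax : 0 < Mmax := lt_of_lt_of_le hM0 (hMle s τ)
  have hfin := S.thirdFinal3_of_log_ineq (h := h) (Lb := Lb) (3 ^ (S.d + J) * S₀) t
    (3 ^ (S.d + 1 + 1) - 1) hΛ hDmax hMmax hHp h1 h2
  exact lt_of_lt_of_le hfin
    (SetupQ.thirdThreshold_anti hD0 (hDle s τ) hM0 (hMle s τ) hHp (3 ^ (S.d + 1 + 1) - 1))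

end TwoSetup

end Summit.ABC.StewartYu

end
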